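import Summits.QuantumFields.YangMills.Theorems.UnitScaleTiltProp7LandauTransversalityMarginSU2
import Summits.QuantumFields.YangMills.Theorems.UnitScaleTiltProp7LandauTransversalityReductionSU2
import Summits.QuantumFields.YangMills.Theorems.UnitScaleTiltProp7LandauDivergenceSectors
import Summits.QuantumFields.YangMills.Theorems.UnitScaleTiltProp7TwistedSliceGaugeOntoSU2OfRegPr
import Summits.QuantumFields.YangMills.Theorems.UnitScaleTiltProp7ChartVelocityDexp
import HarnessLib

/-!
# Route `UnitScaleTilt`, crux K1 child «MinimiserStabilityRegPr» (stmt-QuantumFields-19200), skeleton v10, stub `stub_existenceMinimalOrbit` (EX), route (α) —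
# **(P2) «LANDAU TRANSVERSALITY AT THE CHART POINT» IN `hSplitD`'s REAL CURRENCY FROM THE COMPLEX PAIRING TEST, WITH EVERY SECTOR ROW DISCHARGED**: the chart-level composition
# ★★★`hSplitP2_su2_of_pairing` := ★w5-20520 g7's ✓`Prop7LandauTransversalityMargin.hcore_su2_of_pairing` (R2-M-su2, abstract; seven displayed sector rows) ∘ ★px10 g0's
# ✓`Prop7LandauTransversalityReduction.hSplitP2_su2_of_core` (R1b) AT THE CHART `A₁ := χ(A′)`, `T := D(log U̿^{twS})(A₁)`, `D := Dχ(A′)`, for the CONSUMER'S letters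
# `M b := g(ad(−A₁(b)))` (✓`Prop7FibreELOfCritSplitD`'s `hSplitD`) and `Gd N b := iN(b₋) − U′(b)·iN(b₊)·U′(b)⋆` at any `SU(2)`-valued `U′` — the seven rows supplied BY NAME:
# `hsu2pre` ✓R1b `exists_su2_kerQTwS_of_sliceTangent`; `hTsu`∕`hTsc` this lineage's (S1)∕(S2) ✓`fderiv_logChartTwS_su2`∕✓`fderiv_logChartTwS_central` (tower rows ✓`towerRows_at_of_regPr`);
# `hGsu`∕`hGsc` ✓`star_gSer_ad_apply`∕✓`trace_gSer_ad_apply_eq`∕✓`gSer_ad_apply_smul_one` + injectivity ✓`isUnit_gSer_ad_neg` + unitarity; `hLsu`∕`hLsc`∕`hΔsu` part 1∕2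
# ✓`Prop7LandauDivergenceSectors.RSPi_DstarPi_su2∕central_of_regPr`∕✓`covLapSite_su2`.

Cell `ym3-torus`, width seat `ym-ust-20520-w4` (gen 7).  THEOREMS ONLY (0 `def`, 0 `sorry`).  Part 2∕2 of «(R2-M-su2-chart)» (★w5-20520 g7's word, bus 2026-08-28 18:35:27Z (2)).
`--supports stmt-QuantumFields-19200 --as helper`, count-neutral.  YM₃ on T³ is a ladder rung (R3), not the Clay problem; nothing here claims the stub, the crux, d = 4 or the mass gap.

WHAT IS PROVED (member `F`, `h : n ≤ K`; sorry-free, no definition; ns `…Theorems.Prop7LandauTransversalityMarginSU2Chart`):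
* §1 `injective_of_isUnit`, `stencil_skewHermitian_traceless` (following ★px20 g0's withdrawn letter), ★`su2_of_gSer_ad_eq_stencil` (= `hGsu` for the consumer's letters),
  ★`central_of_gSer_ad_eq_stencil` (= `hGsc`).
* §2 ★`fderiv_logChartTwS_central_of_regPr` (= `hTsc`: (S2) in the scalar-row currency, tower rows discharged), `chartPoint_su2_norm` (`‖χ(A′)‖ < e·η`, `χ(A′)` skew-Hermitian traceless,
  `‖χ(A′)(b)‖ ≤ ½` — ✓`isHermitian_trace_zero_of_chartS`, `Chart47T3twS`, `6ε ≤ e·η`).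
* §3 ★★★`hSplitP2_su2_of_pairing` — in the (D47) window of ✓`hSplitP2_su2_of_core` (`U₀ ∈ 𝔘_k(ε₀)`, `10⁹L²e ≤ 1`, `10¹²L³ε₀ ≤ 1`, `‖HY‖ ≤ b‖Y‖`, `H` real, `9C₂ˢbε < 1`, `6ε ≤ e·η`,
  `Chart47T3twS C₂ˢ ε U₀ H`, `Q(U₀)∘H = id`, `2‖A′‖ < ε`, `A′` skew-Hermitian traceless, `HasFDerivAt χ D A′`) with the knit's Landau row `h45L` and ANY `SU(2)`-valued `U′`: IF the COMPLEX pairing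
  test of ✓`hSplitP2_of_pairing` holds for `M b := g(ad(−χ(A′)(b)))`, `Gd :=` the `U′`-stencil, THEN every skew-Hermitian traceless twisted-slice tangent `β` at `χ(A′)` is
  `g(ad(−χ(A′) b))(β b) = g(ad(−χ(A′) b))(Dδ b) + (iN(b₋) − U′(b)·iN(b₊)·U′(b)⋆)` with `δ` skew-Hermitian traceless, `Q(U₀)δ = 0`, `IsLandauPrintS U₀ δ`, `N` Hermitian traceless — NO displayed
  sector row.  ONE pairing test (the complex one of ✓R2-M, supplier = plan v2's estimate files) feeds both currencies.
* §4 ★★`hSplitP2_su2_of_pairing_exp` — the same with `U′(b) = e^{χ(A′)(b)}U₀(b)` (`hU′`) and the pairing test in the SUPPLIER's complex stencil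
  «`g(ad(−χ(A′) b))(w b) = N″(b₋) − e^{χ(A′)(b)}(U₀(b)N″(b₊)U₀(b)⋆)e^{−χ(A′)(b)}`» (★w5-20520 g7's (hS) row ✓`norm_DstarL2_transfer_le` ∕ ✓`htest_of_suppliers`), by `N′ := −i·N″`.
INHABITABILITY (★★OWNER RULING g27-№9 (3)): no new displayed row relative to ✓`hSplitP2_of_pairing` + ✓`hSplitP2_su2_of_core` (`hHR`, `hA′R` are the knit's displayed reality rows; `U′` is
free — the consumer takes `U′ := emb15 U₀ (expHermField X)`).
HONEST SCOPE.  Exact bookkeeping over landed letters; the pairing test is a HYPOTHESIS (its supplier — nested-mean block Poincaré (Q1) ✓, (E1) ✓, the level-dependent tower closeness R2t′,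
the `η`-free right inverse R2q″, the assembly R2b′ — is ★w5-20520 g7's plan v2, NOT here); nothing of print is asserted; no stub ∕ crux statement is advanced.

References: T. Bałaban, CMP 102 (1985) 277–309 [Balaban1985Variational] ((44)–(51) pp.285–286, (82)–(83) p.290, Prop. 3 p.289); CMP 99 (1985) 389–434
[Balaban1985BackgroundPropagators] ((3.3) p.391, (3.8) p.392, (3.13)–(3.15) p.393, (3.20)–(3.23) p.394, (3.115) p.418); CMP 98 (1985) 17–51 [Balaban1985Averaging] ((32)–(34) pp.22–23,
(89)–(92) p.31, (125)–(127) p.36); CMP 99 (1985) 75–102 [Balaban1985RegularSpaces] (Sect. D pp.89–95).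
-/

set_option autoImplicit false

noncomputable section

open scoped InnerProductSpace Matrix.Norms.L2Operator Matrix
open Filter Metric NormedSpace

namespace Summit.QuantumFields.YangMills.Theorems.Prop7LandauTransversalityMarginSU2Chart

open Literature.Analysis.Calculus.ExpDifferential (ad gSer)
open Literature.MathematicalPhysics.QuantumFieldTheory.Balaban1983to89
open Literature.MathematicalPhysics.QuantumFieldTheory.Balaban1983to89.T3ContinuumYM3Torus
open T4Continuum BlockAveraging ExpMeanLog
open B7Prop1Explicit (expUnit)
open T3PrintedRegularMinimiser (RegPr)
open T3SectALandauChart (eta eta_pos bgUnits)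
open B11Prop3Model (Dfix)
open B11Eq103H1Complex (SiteL2K BondL2K)
open Summit.QuantumFields.YangMills.Theorems.Prop8Chart (loopHolU emlIterU)
open Summit.QuantumFields.YangMills.Theorems.Prop7SectET3Transport (periodsT3)
open Summit.QuantumFields.YangMills.Theorems.Prop7SymAvgTwSym (tstairU dbarCovIterU logChartTwS QTwS CmapTwS Chart47T3twS)
open Summit.QuantumFields.YangMills.Theorems.Prop7SectET3HilbertLetters (W₂ toL2 toL2S DL2 covLapSite)
open Summit.QuantumFields.YangMills.Theorems.Prop7SectET3GaugeProjector (NS RSPi DstarPi)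
open Summit.QuantumFields.YangMills.Theorems.Prop7SPrint (IsLandauPrintS)
open Summit.QuantumFields.YangMills.Theorems.Prop7ChartVelocityDexp (isUnit_gSer_ad_neg)
open Summit.QuantumFields.YangMills.Theorems.Prop7TwistedSliceGaugeOntoSU2 (star_gSer_ad_apply trace_gSer_ad_apply_eq gSer_ad_apply_smul_one fderiv_logChartTwS_su2
  fderiv_logChartTwS_central towerRows_at_of_regPr)
open Summit.QuantumFields.YangMills.Theorems.Prop7ChartRealityKnitS (isHermitian_trace_zero_of_chartS)
open Summit.QuantumFields.YangMills.Theorems.Prop7LandauTransversalityReduction (hSplitP2_su2_of_core exists_su2_kerQTwS_of_sliceTangent)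
open Summit.QuantumFields.YangMills.Theorems.Prop7LandauTransversalityMargin (exists_sub_chartDeriv_eq_H hcore_su2_of_pairing)
open Summit.QuantumFields.YangMills.Theorems.Prop7LandauDivergenceSectors (RSPi_DstarPi_su2_of_regPr RSPi_DstarPi_central_of_regPr covLapSite_su2)

variable (F : T3Family) {n K : ℕ} (h : n ≤ K)

/-! ## §1 The sector rows of the pulled gauge direction for the consumer's letters `M b := g(ad(−A₁(b)))`, `Gd N b := iN(b₋) − U′(b)·iN(b₊)·U′(b)⋆` -/

/-- a continuous linear map that is a unit of the operator algebra is injective. [folklore] -/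
theorem injective_of_isUnit {E : Type*} [NormedAddCommGroup E] [NormedSpace ℂ E] {T : E →L[ℂ] E} (hT : IsUnit T) : Function.Injective T := by
  obtain ⟨u, hu⟩ := hT
  intro x y hxy
  have hinv : ∀ z, ((u⁻¹ : (E →L[ℂ] E)ˣ) : E →L[ℂ] E) ((u : E →L[ℂ] E) z) = z := fun z => by
    show ((u⁻¹ * u : (E →L[ℂ] E)ˣ) : E →L[ℂ] E) z = z
    rw [inv_mul_cancel]
    rfl
  rw [← hu] at hxy
  rw [← hinv x, ← hinv y, hxy]

/-- the `b.src ∕ b.tgt` gauge stencil `iX − U·(iY)·U⋆` of Hermitian traceless `X, Y` at a unitary `U` is skew-Hermitian traceless (following ★px20 g0's withdrawn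
`Prop7LandauTransversalityCoreDoor.stencil_skewHermitian_traceless`). [cite: Balaban1985BackgroundPropagators, (3.3) p.391, p.393] -/
theorem stencil_skewHermitian_traceless (U X Y : Matrix (Fin 2) (Fin 2) ℂ) (hU : star U * U = 1) (hX : star X = X) (hXt : X.trace = 0)
    (hY : star Y = Y) (hYt : Y.trace = 0) :
    star (Complex.I • X - U * (Complex.I • Y) * star U) = -(Complex.I • X - U * (Complex.I • Y) * star U) ∧
      (Complex.I • X - U * (Complex.I • Y) * star U).trace = 0 := by
  refine ⟨?_, ?_⟩
  · have e1 : U * ((-Complex.I) • Y * star U) = -(U * (Complex.I • Y) * star U) := by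
      rw [neg_smul, neg_mul, mul_neg, mul_assoc]
    rw [star_sub, star_mul, star_mul, star_star, star_smul, star_smul, hX, hY, Complex.star_def, Complex.conj_I, e1, neg_smul]
    abel
  · rw [Matrix.trace_sub, Matrix.trace_smul, hXt, smul_zero, Matrix.trace_mul_cycle, hU, one_mul, Matrix.trace_smul, hYt, smul_zero, sub_zero]

/-- ★ **`hGsu` FOR THE CONSUMER'S LETTERS**: if `A₁` is skew-Hermitian traceless with `‖A₁(b)‖ ≤ ½` and `U′` is `SU(2)`-valued, then every `w` with `g(ad(−A₁ b))(w b) = iN(b₋) − U′(b)·iN(b₊)·U′(b)⋆`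
bondwise, `N` Hermitian traceless, is skew-Hermitian traceless: `g(ad(−A₁ b))` is injective (✓`isUnit_gSer_ad_neg`), commutes with `star` (✓`star_gSer_ad_apply`) and preserves the trace
(✓`trace_gSer_ad_apply_eq`), and the stencil is skew-Hermitian traceless. [cite: Balaban1985Averaging, (32)–(34) pp.22–23; Balaban1985BackgroundPropagators, (3.3) p.391, p.393; Balaban1985Variational, (51) p.286] -/
theorem su2_of_gSer_ad_eq_stencil (A₁ : PBond (F.P K) 0 → Matrix (Fin 2) (Fin 2) ℂ) (hA₁R : ∀ b, star (A₁ b) = -A₁ b ∧ (A₁ b).trace = 0) (hA₁2 : ∀ b, ‖A₁ b‖ ≤ 1 / 2)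
    (U' : GaugeField (F.P K) 0 (Matrix.specialUnitaryGroup (Fin 2) ℂ)) :
    ∀ (N : Site (F.P K) 0 → Matrix (Fin 2) (Fin 2) ℂ) (w : PBond (F.P K) 0 → Matrix (Fin 2) (Fin 2) ℂ),
      (∀ x, (N x).IsHermitian ∧ (N x).trace = 0) →
      (∀ b, gSer ℂ (ad ℂ (-A₁ b)) (w b) =
        Complex.I • N b.src - ((U' b : Matrix.specialUnitaryGroup (Fin 2) ℂ) : Matrix (Fin 2) (Fin 2) ℂ) * (Complex.I • N b.tgt) * star ((U' b : Matrix.specialUnitaryGroup (Fin 2) ℂ) : Matrix (Fin 2) (Fin 2) ℂ)) →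
      ∀ b, star (w b) = -w b ∧ (w b).trace = 0 := by
  intro N w hN hw b
  have hU : star (((U' b : Matrix.specialUnitaryGroup (Fin 2) ℂ) : Matrix (Fin 2) (Fin 2) ℂ)) * ((U' b : Matrix.specialUnitaryGroup (Fin 2) ℂ) : Matrix (Fin 2) (Fin 2) ℂ) = 1 :=
    Matrix.mem_unitaryGroup_iff'.1 (U' b).2.1
  have hs := stencil_skewHermitian_traceless _ _ _ hU (by rw [Matrix.star_eq_conjTranspose]; exact (hN b.src).1) (hN b.src).2
    (by rw [Matrix.star_eq_conjTranspose]; exact (hN b.tgt).1) (hN b.tgt).2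
  have hinj := injective_of_isUnit (isUnit_gSer_ad_neg (hA₁2 b))
  have hY : star (-A₁ b) = -(-A₁ b) := by rw [star_neg, (hA₁R b).1]
  refine ⟨hinj ?_, ?_⟩
  · rw [← star_gSer_ad_apply hY, map_neg, hw b, hs.1]
  · rw [← trace_gSer_ad_apply_eq (-A₁ b) (w b), hw b, hs.2]

/-- ★ **`hGsc` FOR THE CONSUMER'S LETTERS**: for a scalar parameter `N = c·1` the stencil is the central field `i(c(b₋) − c(b₊))·1` (`U′U′⋆ = 1`), and `g(ad(−A₁ b))` fixes the centre
(✓`gSer_ad_apply_smul_one`) and is injective, so `w(b)` is central. [cite: Balaban1985Averaging, (32)–(34) pp.22–23; Balaban1985BackgroundPropagators, (3.3) p.391, p.393] -/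
theorem central_of_gSer_ad_eq_stencil (A₁ : PBond (F.P K) 0 → Matrix (Fin 2) (Fin 2) ℂ) (hA₁2 : ∀ b, ‖A₁ b‖ ≤ 1 / 2)
    (U' : GaugeField (F.P K) 0 (Matrix.specialUnitaryGroup (Fin 2) ℂ)) :
    ∀ (c : Site (F.P K) 0 → ℂ) (w : PBond (F.P K) 0 → Matrix (Fin 2) (Fin 2) ℂ),
      (∀ b, gSer ℂ (ad ℂ (-A₁ b)) (w b) =
        Complex.I • (fun x => c x • (1 : Matrix (Fin 2) (Fin 2) ℂ)) b.src
          - ((U' b : Matrix.specialUnitaryGroup (Fin 2) ℂ) : Matrix (Fin 2) (Fin 2) ℂ) * (Complex.I • (fun x => c x • (1 : Matrix (Fin 2) (Fin 2) ℂ)) b.tgt)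
            * star ((U' b : Matrix.specialUnitaryGroup (Fin 2) ℂ) : Matrix (Fin 2) (Fin 2) ℂ)) →
      ∀ b, ∃ z : ℂ, w b = z • (1 : Matrix (Fin 2) (Fin 2) ℂ) := by
  intro c w hw b
  have hU : ((U' b : Matrix.specialUnitaryGroup (Fin 2) ℂ) : Matrix (Fin 2) (Fin 2) ℂ) * star (((U' b : Matrix.specialUnitaryGroup (Fin 2) ℂ) : Matrix (Fin 2) (Fin 2) ℂ)) = 1 :=
    Matrix.mem_unitaryGroup_iff.1 (U' b).2.1
  have hinj := injective_of_isUnit (isUnit_gSer_ad_neg (hA₁2 b))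
  refine ⟨Complex.I * c b.src - Complex.I * c b.tgt, hinj ?_⟩
  rw [hw b, gSer_ad_apply_smul_one]
  simp only [smul_smul, Matrix.mul_smul, Matrix.smul_mul, Matrix.mul_one, hU, sub_smul]

/-! ## §2 The `𝔰𝔲(2)` chart point: norm, reality, and the scalar row of the linearised twisted chart with its tower rows discharged -/

/-- ★ **(S2) IN THE SCALAR-ROW CURRENCY, NO DISPLAYED TOWER ROW**: at `U₀ ∈ 𝔘_k(ε₀)` (`10⁹L²e ≤ 1`, `10¹²L³ε₀ ≤ 1`) and `‖A₁‖ < e·η`, the linearised twisted chart `D(log U̿^{twS})(A₁)` maps every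
central field (`w b = z_b·1`) to a central coarse field — ✓`fderiv_logChartTwS_central` with its `1∕8` rows supplied by ✓`towerRows_at_of_regPr`.
[cite: Balaban1985BackgroundPropagators, (3.13)–(3.15) p.393; Balaban1985Averaging, (89)–(92) p.31, (125)–(127) p.36] -/
theorem fderiv_logChartTwS_central_of_regPr {ε₀ e : ℝ} (hε₀ : 0 < ε₀) (he : 0 < e) (hWe : 10 ^ 9 * (F.L : ℝ) ^ 2 * e ≤ 1) (hWε : 10 ^ 12 * (F.L : ℝ) ^ 3 * ε₀ ≤ 1)
    (U₀ : GaugeField (F.P K) 0 (Matrix.specialUnitaryGroup (Fin 2) ℂ)) (hreg : RegPr F n K ε₀ U₀)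
    {A₁ : PBond (F.P K) 0 → Matrix (Fin 2) (Fin 2) ℂ} (hA₁ : ‖A₁‖ < e * eta F n K) :
    ∀ w : PBond (F.P K) 0 → Matrix (Fin 2) (Fin 2) ℂ, (∀ b, ∃ z : ℂ, w b = z • (1 : Matrix (Fin 2) (Fin 2) ℂ)) →
      ∀ c, ∃ z : ℂ, fderiv ℂ (logChartTwS F n K h U₀) A₁ w c = z • (1 : Matrix (Fin 2) (Fin 2) ℂ) := by
  intro w hw c
  choose s hs using hw
  have hweq : w = fun b => s b • (1 : Matrix (Fin 2) (Fin 2) ℂ) := funext hs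
  subst hweq
  obtain ⟨hWl, hT⟩ := towerRows_at_of_regPr F hε₀ he hWe hWε U₀ hreg hA₁
  exact ⟨_, fderiv_logChartTwS_central F h hε₀ he hWe hWε U₀ hreg hA₁ hWl hT s c⟩

/-- **THE CHART POINT `A₁ := χ(A′) = A′ − H·Dfix(CmapTwS U₀) H C₂ˢ A′` IS `𝔰𝔲(2)`-VALUED, IN THE BALL `‖A₁‖ < e·η`, WITH `‖A₁(b)‖ ≤ ½`** (in the (D47) window with `H` real and `A′`
`𝔰𝔲(2)`-valued: ✓`isHermitian_trace_zero_of_chartS` at `X := −i·χ(A′)`; `‖χ(A′)‖ < 2ε` by `Chart47T3twS`, `6ε ≤ e·η`, `10⁹L²e ≤ 1`, `η ≤ 1`).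
[cite: Balaban1985Variational, (47)–(51) pp.285–286, Prop. 3 p.289; Balaban1985BackgroundPropagators, (3.14) p.393] -/
theorem chartPoint_su2_norm [Fact (0 < (F.L : ℝ))] [Fact (0 < ((F.L : ℝ)⁻¹) ^ (K - n))]
    {ε₀ e b ε : ℝ} (hε₀ : 0 < ε₀) (he : 0 < e) (hWe : 10 ^ 9 * (F.L : ℝ) ^ 2 * e ≤ 1) (hWε : 10 ^ 12 * (F.L : ℝ) ^ 3 * ε₀ ≤ 1)
    (U₀ : GaugeField (F.P K) 0 (Matrix.specialUnitaryGroup (Fin 2) ℂ)) (hreg : RegPr F n K ε₀ U₀)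
    {H : (PBond (F.P n) 0 → Matrix (Fin 2) (Fin 2) ℂ) →ₗ[ℂ] (PBond (F.P K) 0 → Matrix (Fin 2) (Fin 2) ℂ)} (hb : 0 ≤ b) (hHop : ∀ Y, ‖H Y‖ ≤ b * ‖Y‖)
    (hHR : ∀ Y : PBond (F.P n) 0 → Matrix (Fin 2) (Fin 2) ℂ, (∀ c, star (Y c) = -Y c ∧ (Y c).trace = 0) → ∀ b', star (H Y b') = -H Y b' ∧ (H Y b').trace = 0)
    (hq : 9 * (40 * (2 * (3 * (2 * e + 2700 * (F.L : ℝ) * ε₀))) / (e * eta F n K) ^ 2) * b * ε < 1) (hRε : 6 * ε ≤ e * eta F n K)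
    (h47 : Chart47T3twS F n K h (40 * (2 * (3 * (2 * e + 2700 * (F.L : ℝ) * ε₀))) / (e * eta F n K) ^ 2) ε U₀ H)
    {A' : PBond (F.P K) 0 → Matrix (Fin 2) (Fin 2) ℂ} (hA' : ‖A'‖ < ε) (hA'R : ∀ b', star (A' b') = -A' b' ∧ (A' b').trace = 0) :
    ‖A' - H (Dfix (CmapTwS F n K h U₀) H (40 * (2 * (3 * (2 * e + 2700 * (F.L : ℝ) * ε₀))) / (e * eta F n K) ^ 2) A')‖ < e * eta F n K ∧
    (∀ b', star ((A' - H (Dfix (CmapTwS F n K h U₀) H (40 * (2 * (3 * (2 * e + 2700 * (F.L : ℝ) * ε₀))) / (e * eta F n K) ^ 2) A')) b') =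
        -(A' - H (Dfix (CmapTwS F n K h U₀) H (40 * (2 * (3 * (2 * e + 2700 * (F.L : ℝ) * ε₀))) / (e * eta F n K) ^ 2) A')) b' ∧
      ((A' - H (Dfix (CmapTwS F n K h U₀) H (40 * (2 * (3 * (2 * e + 2700 * (F.L : ℝ) * ε₀))) / (e * eta F n K) ^ 2) A')) b').trace = 0) ∧
    (∀ b', ‖(A' - H (Dfix (CmapTwS F n K h U₀) H (40 * (2 * (3 * (2 * e + 2700 * (F.L : ℝ) * ε₀))) / (e * eta F n K) ^ 2) A')) b'‖ ≤ 1 / 2) := by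
  set A₁ := A' - H (Dfix (CmapTwS F n K h U₀) H (40 * (2 * (3 * (2 * e + 2700 * (F.L : ℝ) * ε₀))) / (e * eta F n K) ^ 2) A') with hA₁def
  have hε : 0 < ε := lt_of_le_of_lt (norm_nonneg A') hA'
  have h2ε : ‖A₁‖ < 2 * ε := h47.2.2.1 A' hA'
  have hA₁e : ‖A₁‖ < e * eta F n K := by linarith
  -- reality through ✓`isHermitian_trace_zero_of_chartS`
  have hX := isHermitian_trace_zero_of_chartS F h hε₀ he hWe hWε U₀ hreg hb hHop hHR hq hRε hA' hA'R (X := fun b' => (-Complex.I) • A₁ b')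
    (by rw [← hA₁def]; funext b'; simp only [smul_smul, mul_neg, Complex.I_mul_I, neg_neg, one_smul])
  have hA₁R : ∀ b', star (A₁ b') = -A₁ b' ∧ (A₁ b').trace = 0 := by
    intro b'
    obtain ⟨hH, htr⟩ := hX b'
    refine ⟨?_, ?_⟩
    · have h1 : ((-Complex.I) • A₁ b')ᴴ = (-Complex.I) • A₁ b' := hH
      rw [Matrix.conjTranspose_smul, star_neg, Complex.star_def, Complex.conj_I, neg_neg] at h1
      have h2 := congrArg (fun M : Matrix (Fin 2) (Fin 2) ℂ => Complex.I • M) h1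
      rw [smul_smul, smul_smul, Complex.I_mul_I, mul_neg, Complex.I_mul_I, neg_neg, one_smul, neg_one_smul] at h2
      rw [Matrix.star_eq_conjTranspose]
      exact neg_eq_iff_eq_neg.mp h2
    · have h3 : (-Complex.I) • (A₁ b').trace = 0 := by rw [← Matrix.trace_smul]; exact htr
      exact (smul_eq_zero.1 h3).resolve_left (neg_ne_zero.2 Complex.I_ne_zero)
  -- the pointwise bound `‖A₁ b‖ ≤ e·η ≤ ½`
  have hL1 : (1 : ℝ) ≤ (F.L : ℝ) := by exact_mod_cast F.hL.2.le
  have he1 : e ≤ 1 / 2 := by nlinarith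
  have hη1 : eta F n K ≤ 1 := by
    show ((F.L : ℝ)⁻¹) ^ (K - n) ≤ 1
    exact pow_le_one₀ (inv_nonneg.2 (by positivity)) (inv_le_one_of_one_le₀ hL1)
  have hη0 : 0 < eta F n K := eta_pos F n K
  have hA₁2 : ∀ b', ‖A₁ b'‖ ≤ 1 / 2 := fun b' => ((norm_le_pi_norm A₁ b').trans hA₁e.le).trans (by nlinarith)
  exact ⟨hA₁e, hA₁R, hA₁2⟩

/-! ## §3 (P2) in the real currency from the complex pairing test, every sector row discharged -/

/-- ★★★ **(P2) «LANDAU TRANSVERSALITY AT THE CHART POINT» IN `hSplitD`'s REAL CURRENCY FROM THE COMPLEX PAIRING TEST — NO DISPLAYED SECTOR ROW.**  In the (D47) window of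
✓`hSplitP2_su2_of_core` with the knit's Landau row `h45L : ∀ Y, IsLandauPrintS U₀ (H Y)` and ANY `SU(2)`-valued `U′`: IF for every residual gauge parameter `l` (`toL2S l ∈ N_S(U₀)`) with
`Δ^η_{U₀} l ≠ 0` there are `N′` and `w` with `g(ad(−χ(A′) b))(w b) = iN′(b₋) − U′(b)·iN′(b₊)·U′(b)⋆` bondwise, `D(log U̿^{twS})(χ(A′)) w = 0` and `⟪toL2 w, D_{U₀}Δ^η_{U₀} l⟫ ≠ 0` (the COMPLEX
pairing test of ✓`Prop7LandauTransversalityMargin.hSplitP2_of_pairing`, verbatim for these letters), THEN every skew-Hermitian traceless `β` with `D(log U̿^{twS})(χ(A′)) β = 0` is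
`g(ad(−χ(A′) b))(β b) = g(ad(−χ(A′) b))((Dδ) b) + (iN(b₋) − U′(b)·iN(b₊)·U′(b)⋆)` with `δ` skew-Hermitian traceless, `Q(U₀)δ = 0`, `IsLandauPrintS U₀ δ`, `N` Hermitian traceless.
Proof: ✓`hcore_su2_of_pairing` (★w5-20520 g7) with its seven sector rows supplied by §1–§2, part 1∕2 (✓`Prop7LandauDivergenceSectors`) and ✓R1b, then ✓`hSplitP2_su2_of_core`.
[cite: Balaban1985Variational, (44)–(51) pp.285–286, (82)–(83) p.290, Prop. 3 p.289; Balaban1985BackgroundPropagators, (3.3) p.391, (3.8) p.392, (3.13)–(3.15) p.393, (3.20)–(3.23) p.394, (3.115) p.418; Balaban1985Averaging, (32)–(34) pp.22–23; Balaban1985RegularSpaces, Sect. D pp.89–95] -/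
theorem hSplitP2_su2_of_pairing [Fact (0 < (F.L : ℝ))] [Fact (0 < ((F.L : ℝ)⁻¹) ^ (K - n))] {c₀ cB : ℝ} [Fact (0 < c₀)] [Fact (0 < cB)]
    {ε₀ e b ε : ℝ} (hε₀ : 0 < ε₀) (he : 0 < e) (hWe : 10 ^ 9 * (F.L : ℝ) ^ 2 * e ≤ 1) (hWε : 10 ^ 12 * (F.L : ℝ) ^ 3 * ε₀ ≤ 1)
    (U₀ : GaugeField (F.P K) 0 (Matrix.specialUnitaryGroup (Fin 2) ℂ)) (hreg : RegPr F n K ε₀ U₀)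
    {H : (PBond (F.P n) 0 → Matrix (Fin 2) (Fin 2) ℂ) →ₗ[ℂ] (PBond (F.P K) 0 → Matrix (Fin 2) (Fin 2) ℂ)} (hb : 0 ≤ b) (hHop : ∀ Y, ‖H Y‖ ≤ b * ‖Y‖)
    (hHR : ∀ Y : PBond (F.P n) 0 → Matrix (Fin 2) (Fin 2) ℂ, (∀ c, star (Y c) = -Y c ∧ (Y c).trace = 0) → ∀ b', star (H Y b') = -H Y b' ∧ (H Y b').trace = 0)
    (hq : 9 * (40 * (2 * (3 * (2 * e + 2700 * (F.L : ℝ) * ε₀))) / (e * eta F n K) ^ 2) * b * ε < 1) (hRε : 6 * ε ≤ e * eta F n K)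
    (h47 : Chart47T3twS F n K h (40 * (2 * (3 * (2 * e + 2700 * (F.L : ℝ) * ε₀))) / (e * eta F n K) ^ 2) ε U₀ H) (hQH : ∀ X, QTwS F n K h U₀ (H X) = X)
    (h45L : ∀ Y, IsLandauPrintS F n K h c₀ cB U₀ (H Y))
    {A' : PBond (F.P K) 0 → Matrix (Fin 2) (Fin 2) ℂ} (hA' : 2 * ‖A'‖ < ε) (hA'R : ∀ b', star (A' b') = -A' b' ∧ (A' b').trace = 0)
    {D : (PBond (F.P K) 0 → Matrix (Fin 2) (Fin 2) ℂ) →L[ℂ] (PBond (F.P K) 0 → Matrix (Fin 2) (Fin 2) ℂ)}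
    (hD : HasFDerivAt (fun A : PBond (F.P K) 0 → Matrix (Fin 2) (Fin 2) ℂ => A - H (Dfix (CmapTwS F n K h U₀) H (40 * (2 * (3 * (2 * e + 2700 * (F.L : ℝ) * ε₀))) / (e * eta F n K) ^ 2) A)) D A')
    (U' : GaugeField (F.P K) 0 (Matrix.specialUnitaryGroup (Fin 2) ℂ))
    (htest : ∀ l : Site (F.P K) 0 → Matrix (Fin 2) (Fin 2) ℂ, toL2S F K c₀ l ∈ NS F n K h c₀ cB U₀ →
      covLapSite F n K c₀ U₀ (toL2S F K c₀ l) ≠ 0 →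
      ∃ (N' : Site (F.P K) 0 → Matrix (Fin 2) (Fin 2) ℂ) (w : PBond (F.P K) 0 → Matrix (Fin 2) (Fin 2) ℂ),
        (∀ b, gSer ℂ (ad ℂ (-(A' - H (Dfix (CmapTwS F n K h U₀) H (40 * (2 * (3 * (2 * e + 2700 * (F.L : ℝ) * ε₀))) / (e * eta F n K) ^ 2) A')) b)) (w b) = Complex.I • N' b.src - ((U' b : Matrix.specialUnitaryGroup (Fin 2) ℂ) : Matrix (Fin 2) (Fin 2) ℂ) * (Complex.I • N' b.tgt) * star ((U' b : Matrix.specialUnitaryGroup (Fin 2) ℂ) : Matrix (Fin 2) (Fin 2) ℂ)) ∧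
        fderiv ℂ (logChartTwS F n K h U₀) (A' - H (Dfix (CmapTwS F n K h U₀) H (40 * (2 * (3 * (2 * e + 2700 * (F.L : ℝ) * ε₀))) / (e * eta F n K) ^ 2) A')) w = 0 ∧
        ⟪toL2 F K c₀ w, DL2 F n K c₀ U₀ (covLapSite F n K c₀ U₀ (toL2S F K c₀ l))⟫_ℂ ≠ 0)
    (β : PBond (F.P K) 0 → Matrix (Fin 2) (Fin 2) ℂ) (hβR : ∀ b', star (β b') = -β b' ∧ (β b').trace = 0)
    (hβ : fderiv ℂ (logChartTwS F n K h U₀) (A' - H (Dfix (CmapTwS F n K h U₀) H (40 * (2 * (3 * (2 * e + 2700 * (F.L : ℝ) * ε₀))) / (e * eta F n K) ^ 2) A')) β = 0) :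
    ∃ δ : PBond (F.P K) 0 → Matrix (Fin 2) (Fin 2) ℂ, (∀ b', star (δ b') = -δ b' ∧ (δ b').trace = 0) ∧ QTwS F n K h U₀ δ = 0 ∧ IsLandauPrintS F n K h c₀ cB U₀ δ ∧
      ∃ N : Site (F.P K) 0 → Matrix (Fin 2) (Fin 2) ℂ, (∀ x, (N x).IsHermitian ∧ (N x).trace = 0) ∧
        ∀ b, gSer ℂ (ad ℂ (-(A' - H (Dfix (CmapTwS F n K h U₀) H (40 * (2 * (3 * (2 * e + 2700 * (F.L : ℝ) * ε₀))) / (e * eta F n K) ^ 2) A')) b)) (β b) = gSer ℂ (ad ℂ (-(A' - H (Dfix (CmapTwS F n K h U₀) H (40 * (2 * (3 * (2 * e + 2700 * (F.L : ℝ) * ε₀))) / (e * eta F n K) ^ 2) A')) b)) (D δ b) + (Complex.I • N b.src - ((U' b : Matrix.specialUnitaryGroup (Fin 2) ℂ) : Matrix (Fin 2) (Fin 2) ℂ) * (Complex.I • N b.tgt) * star ((U' b : Matrix.specialUnitaryGroup (Fin 2) ℂ) : Matrix (Fin 2) (Fin 2) ℂ)) := by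
  have hA'1 : ‖A'‖ < ε := by linarith [norm_nonneg A']
  -- the chart point `A₁ := χ(A′)`: in the ball, `𝔰𝔲(2)`-valued, pointwise `≤ ½`
  obtain ⟨hA₁e, hA₁R, hA₁2⟩ := chartPoint_su2_norm F h hε₀ he hWe hWε U₀ hreg hb hHop hHR hq hRε h47 hA'1 hA'R
  set A₁ : PBond (F.P K) 0 → Matrix (Fin 2) (Fin 2) ℂ := A' - H (Dfix (CmapTwS F n K h U₀) H (40 * (2 * (3 * (2 * e + 2700 * (F.L : ℝ) * ε₀))) / (e * eta F n K) ^ 2) A') with hA₁def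
  -- the consumer's letters `M`, `Gd`
  let M : PBond (F.P K) 0 → (Matrix (Fin 2) (Fin 2) ℂ →L[ℂ] Matrix (Fin 2) (Fin 2) ℂ) := fun b => gSer ℂ (ad ℂ (-A₁ b))
  have hMdef : ∀ b x, M b x = gSer ℂ (ad ℂ (-A₁ b)) x := fun b x => rfl
  have hM : ∀ b, Function.Bijective (M b) := fun b => by
    have hinj : Function.Injective (M b) := injective_of_isUnit (isUnit_gSer_ad_neg (hA₁2 b))
    refine ⟨hinj, ?_⟩
    have hs : Function.Surjective ((M b : Matrix (Fin 2) (Fin 2) ℂ →L[ℂ] Matrix (Fin 2) (Fin 2) ℂ) : Matrix (Fin 2) (Fin 2) ℂ →ₗ[ℂ] Matrix (Fin 2) (Fin 2) ℂ) :=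
      LinearMap.injective_iff_surjective.1 hinj
    exact hs
  let Gd : (Site (F.P K) 0 → Matrix (Fin 2) (Fin 2) ℂ) →ₗ[ℂ] (PBond (F.P K) 0 → Matrix (Fin 2) (Fin 2) ℂ) :=
    { toFun := fun N b => Complex.I • N b.src - ((U' b : Matrix.specialUnitaryGroup (Fin 2) ℂ) : Matrix (Fin 2) (Fin 2) ℂ) * (Complex.I • N b.tgt) * star ((U' b : Matrix.specialUnitaryGroup (Fin 2) ℂ) : Matrix (Fin 2) (Fin 2) ℂ)
      map_add' := fun N N' => by
        funext b
        simp only [Pi.add_apply, smul_add, Matrix.mul_add, Matrix.add_mul]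
        abel
      map_smul' := fun z N => by
        funext b
        simp only [Pi.smul_apply, RingHom.id_apply, smul_sub, smul_smul, Matrix.mul_smul, Matrix.smul_mul, mul_comm z Complex.I] }
  have hGd : ∀ N b, Gd N b = Complex.I • N b.src - ((U' b : Matrix.specialUnitaryGroup (Fin 2) ℂ) : Matrix (Fin 2) (Fin 2) ℂ) * (Complex.I • N b.tgt) * star ((U' b : Matrix.specialUnitaryGroup (Fin 2) ℂ) : Matrix (Fin 2) (Fin 2) ℂ) := fun N b => rfl
  -- the seven sector rows, BY NAME
  have hsu2pre : ∀ β : PBond (F.P K) 0 → Matrix (Fin 2) (Fin 2) ℂ, (∀ b, star (β b) = -β b ∧ (β b).trace = 0) →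
      fderiv ℂ (logChartTwS F n K h U₀) A₁ β = 0 →
      ∃ δ₀ : PBond (F.P K) 0 → Matrix (Fin 2) (Fin 2) ℂ, (∀ b, star (δ₀ b) = -δ₀ b ∧ (δ₀ b).trace = 0) ∧ QTwS F n K h U₀ δ₀ = 0 ∧ D δ₀ = β :=
    fun β hβR hβ => exists_su2_kerQTwS_of_sliceTangent F h hε₀ he hWe hWε U₀ hreg hb hHop hHR hq hRε h47 hQH hA' hA'R hD β hβR hβ
  have hGsu : ∀ (N : Site (F.P K) 0 → Matrix (Fin 2) (Fin 2) ℂ) (w : PBond (F.P K) 0 → Matrix (Fin 2) (Fin 2) ℂ),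
      (∀ x, (N x).IsHermitian ∧ (N x).trace = 0) → (∀ b, M b (w b) = Gd N b) → ∀ b, star (w b) = -w b ∧ (w b).trace = 0 :=
    fun N w hN hw => su2_of_gSer_ad_eq_stencil F A₁ hA₁R hA₁2 U' N w hN (fun b => (hMdef b (w b)).symm.trans ((hw b).trans (hGd N b)))
  have hGsc : ∀ (c : Site (F.P K) 0 → ℂ) (w : PBond (F.P K) 0 → Matrix (Fin 2) (Fin 2) ℂ),
      (∀ b, M b (w b) = Gd (fun x => c x • (1 : Matrix (Fin 2) (Fin 2) ℂ)) b) → ∀ b, ∃ z : ℂ, w b = z • (1 : Matrix (Fin 2) (Fin 2) ℂ) :=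
    fun c w hw => central_of_gSer_ad_eq_stencil F A₁ hA₁2 U' c w (fun b => (hMdef b (w b)).symm.trans ((hw b).trans (hGd _ b)))
  have hTsu : ∀ w : PBond (F.P K) 0 → Matrix (Fin 2) (Fin 2) ℂ, (∀ b, star (w b) = -w b ∧ (w b).trace = 0) →
      ∀ c, star (fderiv ℂ (logChartTwS F n K h U₀) A₁ w c) = -fderiv ℂ (logChartTwS F n K h U₀) A₁ w c ∧ (fderiv ℂ (logChartTwS F n K h U₀) A₁ w c).trace = 0 :=
    fun w hw c => fderiv_logChartTwS_su2 F h hε₀ he hWe hWε U₀ hreg hA₁e hA₁R w hw c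
  have hTsc := fderiv_logChartTwS_central_of_regPr F h hε₀ he hWe hWε U₀ hreg hA₁e
  have hLsu := RSPi_DstarPi_su2_of_regPr F h (c₀ := c₀) (cB := cB) hε₀ he hWe hWε U₀ hreg
  have hLsc := RSPi_DstarPi_central_of_regPr F h (c₀ := c₀) (cB := cB) hε₀ he hWe hWε U₀ hreg
  have hΔsu : ∀ l : Site (F.P K) 0 → Matrix (Fin 2) (Fin 2) ℂ, (∀ x, star (l x) = -l x ∧ (l x).trace = 0) →
      ∀ x, star ((toL2S F K c₀).symm (covLapSite F n K c₀ U₀ (toL2S F K c₀ l)) x) = -(toL2S F K c₀).symm (covLapSite F n K c₀ U₀ (toL2S F K c₀ l)) x ∧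
        ((toL2S F K c₀).symm (covLapSite F n K c₀ U₀ (toL2S F K c₀ l)) x).trace = 0 :=
    fun l hl x => covLapSite_su2 F U₀ l hl x
  -- the complex pairing test in the letters `M`, `Gd`
  have htest' : ∀ l : Site (F.P K) 0 → Matrix (Fin 2) (Fin 2) ℂ, toL2S F K c₀ l ∈ NS F n K h c₀ cB U₀ →
      covLapSite F n K c₀ U₀ (toL2S F K c₀ l) ≠ 0 →
      ∃ (N' : Site (F.P K) 0 → Matrix (Fin 2) (Fin 2) ℂ) (w : PBond (F.P K) 0 → Matrix (Fin 2) (Fin 2) ℂ),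
        (∀ b, M b (w b) = Gd N' b) ∧ fderiv ℂ (logChartTwS F n K h U₀) A₁ w = 0 ∧
        ⟪toL2 F K c₀ w, DL2 F n K c₀ U₀ (covLapSite F n K c₀ U₀ (toL2S F K c₀ l))⟫_ℂ ≠ 0 := by
    intro l hl hne
    obtain ⟨N', w, hMw, hTw, hp⟩ := htest l hl hne
    exact ⟨N', w, fun b => by rw [hMdef, hGd]; exact hMw b, hTw, hp⟩
  -- ★w5-20520 g7's abstract twin, then R1b
  have hcore := hcore_su2_of_pairing F h U₀ hQH (exists_sub_chartDeriv_eq_H F h hε₀ he hWe hWε U₀ hreg hb hHop hq hRε hA' hD) h45L M hM Gd htest' hsu2pre hGsu hGsc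
    hTsu hTsc hLsu hLsc hΔsu
  obtain ⟨δ, hδR, hQδ, hLδ, N, hNR, hMN⟩ := hSplitP2_su2_of_core F h hε₀ he hWe hWε U₀ hreg hb hHop hHR hq hRε h47 hQH hA' hA'R hD M (⇑Gd) hcore β hβR hβ
  exact ⟨δ, hδR, hQδ, hLδ, N, hNR, fun b => by have h1 := hMN b; rw [hMdef, hMdef, hGd] at h1; exact h1⟩

/-! ## §4 (v1.1) The same, fed by the pairing test in the SUPPLIER's letters (`U′ = e^{χ(A′)}U₀`, complex stencil) -/

/-- ★★ **(P2) IN THE REAL CURRENCY FROM THE PAIRING TEST IN THE SUPPLIER'S LETTERS.**  As ★★★`hSplitP2_su2_of_pairing`, with `U′(b) = e^{χ(A′)(b)}·U₀(b)` (`hU′`) and the pairing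
test stated for the COMPLEX stencil of the (hS) supplier (★w5-20520 g7's ✓`Prop7GaugeDirRotationDivergence.norm_DstarL2_transfer_le` ∕ ✓`Prop7LandauTransversalityPairing.htest_of_suppliers`):
«`g(ad(−χ(A′) b))(w b) = N″(b₋) − e^{χ(A′)(b)}·(U₀(b)·N″(b₊)·U₀(b)⋆)·e^{−χ(A′)(b)}`» — converted by `N′ := −i·N″` (`U′(b)⋆ = U₀(b)⋆·e^{−χ(A′)(b)}` since `χ(A′)` is skew-Hermitian,
Mathlib `star_exp`). [cite: Balaban1985Variational, (44)–(51) pp.285–286, (82)–(83) p.290; Balaban1985BackgroundPropagators, (3.3) p.391, (3.20)–(3.23) p.394; Balaban1985Averaging, (32)–(34) pp.22–23] -/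
theorem hSplitP2_su2_of_pairing_exp [Fact (0 < (F.L : ℝ))] [Fact (0 < ((F.L : ℝ)⁻¹) ^ (K - n))] {c₀ cB : ℝ} [Fact (0 < c₀)] [Fact (0 < cB)]
    {ε₀ e b ε : ℝ} (hε₀ : 0 < ε₀) (he : 0 < e) (hWe : 10 ^ 9 * (F.L : ℝ) ^ 2 * e ≤ 1) (hWε : 10 ^ 12 * (F.L : ℝ) ^ 3 * ε₀ ≤ 1)
    (U₀ : GaugeField (F.P K) 0 (Matrix.specialUnitaryGroup (Fin 2) ℂ)) (hreg : RegPr F n K ε₀ U₀)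
    {H : (PBond (F.P n) 0 → Matrix (Fin 2) (Fin 2) ℂ) →ₗ[ℂ] (PBond (F.P K) 0 → Matrix (Fin 2) (Fin 2) ℂ)} (hb : 0 ≤ b) (hHop : ∀ Y, ‖H Y‖ ≤ b * ‖Y‖)
    (hHR : ∀ Y : PBond (F.P n) 0 → Matrix (Fin 2) (Fin 2) ℂ, (∀ c, star (Y c) = -Y c ∧ (Y c).trace = 0) → ∀ b', star (H Y b') = -H Y b' ∧ (H Y b').trace = 0)
    (hq : 9 * (40 * (2 * (3 * (2 * e + 2700 * (F.L : ℝ) * ε₀))) / (e * eta F n K) ^ 2) * b * ε < 1) (hRε : 6 * ε ≤ e * eta F n K)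
    (h47 : Chart47T3twS F n K h (40 * (2 * (3 * (2 * e + 2700 * (F.L : ℝ) * ε₀))) / (e * eta F n K) ^ 2) ε U₀ H) (hQH : ∀ X, QTwS F n K h U₀ (H X) = X)
    (h45L : ∀ Y, IsLandauPrintS F n K h c₀ cB U₀ (H Y))
    {A' : PBond (F.P K) 0 → Matrix (Fin 2) (Fin 2) ℂ} (hA' : 2 * ‖A'‖ < ε) (hA'R : ∀ b', star (A' b') = -A' b' ∧ (A' b').trace = 0)
    {D : (PBond (F.P K) 0 → Matrix (Fin 2) (Fin 2) ℂ) →L[ℂ] (PBond (F.P K) 0 → Matrix (Fin 2) (Fin 2) ℂ)}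
    (hD : HasFDerivAt (fun A : PBond (F.P K) 0 → Matrix (Fin 2) (Fin 2) ℂ => A - H (Dfix (CmapTwS F n K h U₀) H (40 * (2 * (3 * (2 * e + 2700 * (F.L : ℝ) * ε₀))) / (e * eta F n K) ^ 2) A)) D A')
    (U' : GaugeField (F.P K) 0 (Matrix.specialUnitaryGroup (Fin 2) ℂ))
    (hU' : ∀ b, ((U' b : Matrix.specialUnitaryGroup (Fin 2) ℂ) : Matrix (Fin 2) (Fin 2) ℂ) = exp ((A' - H (Dfix (CmapTwS F n K h U₀) H (40 * (2 * (3 * (2 * e + 2700 * (F.L : ℝ) * ε₀))) / (e * eta F n K) ^ 2) A')) b) * ((U₀ b : Matrix.specialUnitaryGroup (Fin 2) ℂ) : Matrix (Fin 2) (Fin 2) ℂ))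
    (htest : ∀ l : Site (F.P K) 0 → Matrix (Fin 2) (Fin 2) ℂ, toL2S F K c₀ l ∈ NS F n K h c₀ cB U₀ →
      covLapSite F n K c₀ U₀ (toL2S F K c₀ l) ≠ 0 →
      ∃ (N'' : Site (F.P K) 0 → Matrix (Fin 2) (Fin 2) ℂ) (w : PBond (F.P K) 0 → Matrix (Fin 2) (Fin 2) ℂ),
        (∀ b, gSer ℂ (ad ℂ (-(A' - H (Dfix (CmapTwS F n K h U₀) H (40 * (2 * (3 * (2 * e + 2700 * (F.L : ℝ) * ε₀))) / (e * eta F n K) ^ 2) A')) b)) (w b) =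
          N'' b.src - exp ((A' - H (Dfix (CmapTwS F n K h U₀) H (40 * (2 * (3 * (2 * e + 2700 * (F.L : ℝ) * ε₀))) / (e * eta F n K) ^ 2) A')) b) * (((U₀ b : Matrix.specialUnitaryGroup (Fin 2) ℂ) : Matrix (Fin 2) (Fin 2) ℂ) * N'' b.tgt
            * star ((U₀ b : Matrix.specialUnitaryGroup (Fin 2) ℂ) : Matrix (Fin 2) (Fin 2) ℂ)) * exp (-(A' - H (Dfix (CmapTwS F n K h U₀) H (40 * (2 * (3 * (2 * e + 2700 * (F.L : ℝ) * ε₀))) / (e * eta F n K) ^ 2) A')) b)) ∧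
        fderiv ℂ (logChartTwS F n K h U₀) (A' - H (Dfix (CmapTwS F n K h U₀) H (40 * (2 * (3 * (2 * e + 2700 * (F.L : ℝ) * ε₀))) / (e * eta F n K) ^ 2) A')) w = 0 ∧
        ⟪toL2 F K c₀ w, DL2 F n K c₀ U₀ (covLapSite F n K c₀ U₀ (toL2S F K c₀ l))⟫_ℂ ≠ 0)
    (β : PBond (F.P K) 0 → Matrix (Fin 2) (Fin 2) ℂ) (hβR : ∀ b', star (β b') = -β b' ∧ (β b').trace = 0)
    (hβ : fderiv ℂ (logChartTwS F n K h U₀) (A' - H (Dfix (CmapTwS F n K h U₀) H (40 * (2 * (3 * (2 * e + 2700 * (F.L : ℝ) * ε₀))) / (e * eta F n K) ^ 2) A')) β = 0) :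
    ∃ δ : PBond (F.P K) 0 → Matrix (Fin 2) (Fin 2) ℂ, (∀ b', star (δ b') = -δ b' ∧ (δ b').trace = 0) ∧ QTwS F n K h U₀ δ = 0 ∧ IsLandauPrintS F n K h c₀ cB U₀ δ ∧
      ∃ N : Site (F.P K) 0 → Matrix (Fin 2) (Fin 2) ℂ, (∀ x, (N x).IsHermitian ∧ (N x).trace = 0) ∧
        ∀ b, gSer ℂ (ad ℂ (-(A' - H (Dfix (CmapTwS F n K h U₀) H (40 * (2 * (3 * (2 * e + 2700 * (F.L : ℝ) * ε₀))) / (e * eta F n K) ^ 2) A')) b)) (β b) = gSer ℂ (ad ℂ (-(A' - H (Dfix (CmapTwS F n K h U₀) H (40 * (2 * (3 * (2 * e + 2700 * (F.L : ℝ) * ε₀))) / (e * eta F n K) ^ 2) A')) b)) (D δ b) + (Complex.I • N b.src - ((U' b : Matrix.specialUnitaryGroup (Fin 2) ℂ) : Matrix (Fin 2) (Fin 2) ℂ) * (Complex.I • N b.tgt) * star ((U' b : Matrix.specialUnitaryGroup (Fin 2) ℂ) : Matrix (Fin 2) (Fin 2) ℂ)) := by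
  have hA'1 : ‖A'‖ < ε := by linarith [norm_nonneg A']
  obtain ⟨-, hA₁R, -⟩ := chartPoint_su2_norm F h hε₀ he hWe hWε U₀ hreg hb hHop hHR hq hRε h47 hA'1 hA'R
  refine hSplitP2_su2_of_pairing F h hε₀ he hWe hWε U₀ hreg hb hHop hHR hq hRε h47 hQH h45L hA' hA'R hD U' (fun l hl hne => ?_) β hβR hβ
  obtain ⟨N'', w, hw, hTw, hp⟩ := htest l hl hne
  refine ⟨fun x => (-Complex.I) • N'' x, w, fun b' => ?_, hTw, hp⟩
  have hstar : star ((U' b' : Matrix.specialUnitaryGroup (Fin 2) ℂ) : Matrix (Fin 2) (Fin 2) ℂ) = star (((U₀ b' : Matrix.specialUnitaryGroup (Fin 2) ℂ) : Matrix (Fin 2) (Fin 2) ℂ)) * exp (-(A' - H (Dfix (CmapTwS F n K h U₀) H (40 * (2 * (3 * (2 * e + 2700 * (F.L : ℝ) * ε₀))) / (e * eta F n K) ^ 2) A')) b') := by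
    rw [hU' b', star_mul, star_exp, (hA₁R b').1]
  rw [hw b', hstar, hU' b']
  simp only [smul_smul, Complex.I_mul_I, mul_neg, neg_neg, one_smul, Matrix.mul_assoc]

end Summit.QuantumFields.YangMills.Theorems.Prop7LandauTransversalityMarginSU2Chart

end
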